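import Summits.QuantumFields.YangMills.Theorems.BalabanUVNodesPortS1ChartBlindSharp

/-!
# NODE O port PT-A — FE-1's chart law (T1), brick (B-γ3) of `Lines/pta_residueW-CHART-LAW-PROOF-PLAN-v1.md` §2: THE TRANSFORM OF RECORD OVER THE OFF-CENTRAL BOND VARIABLES ONLY, THROUGH
# THE EXPLICIT-DENSITY CONTINUOUS BLIND CHART OF THE CENTRAL α-WINDOW — nothing displayed but the support clause ([I] (2.10) p.267: «∫ Π_{b ∉ {b₀(c)}} dV′(b) …»)

Cell `ym-nodeO-ideate`, porter seat PT-A-1 (gen 10); `--kind proof --supports stmt-QuantumFields-27930 --as helper`; count-neutral.  [I] = [Balaban1987RG1]; [III] = [Balaban1988Convergent].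
Over ✓`…PortS1ChartBlindSharp` (`exists_blindSharpPerBondCharts_centralWindow_record`), ✓`…PortS1ChartBlind` (`integral_privateChart_eq_integral_offCentral`), dag-n11-w6
✓`…N11TransportOfRecordInPrivateCoordinateChart.transportOfRecord_ae_eq_integral_privateChart_of_support`, dag-n09-w6 ✓`…N09CentralWindowAtRecord` (window facts).

WHAT IS PROVED (0 `def`).  ★★★ `transportOfRecord_ae_eq_integral_offCentral_sharp_record` — at step `k < K` with `0 ≤ α ≤ 1∕24`, `64α ≤ δ_N`, `157α < L^{−(d−1)}`, `offCard∕|Idx| + 150α < 1` and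
a dummy configuration `U₀`: THERE IS a blind sharp bundle `(T, ϑ, jd, jac′)` (all twenty-six clauses of ✓`…ChartBlindSharp` §3: measurability, two-sided inverse on the window, inverse law,
density FORMULA `jd = (jac′ ∘ ϑ)⁻¹` with `jac′` N09's proved forward density made blind, non-vanishing, forward law, continuity of `jac′`∕`ϑ`∕`jd`∕the glued chart, compact image windows,
blindness ×4) such that for EVERY `dU`-integrable measurable density `ρ` supported in the small-loop region `{U | ∀ c i, dist1 (loopHol U c i) ≤ α}`,
`T(ρ)(V) = ∫_{U′ : {b // b ∉ range β} → SU(N)} 𝟙[∀c, V c ∈ T_c Ū′]·Π_c jd_c(Ū′, V c)·ρ(extend β (ϑ_c(Ū′, V c))_c Ū′) d(⊗_{b∉β} dU(b))` for `dV`-a.e. `V`, `Ū′ = ext_{U₀} U′`.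

HONEST FRAMING.  A composition by name; the a.e.-in-`V` seam is N11's (the pointwise reading on `regSetOfRecord` needs the continuity door `hgc` — dag-n09's (C), not here); the density
is N09's log-chart Jacobian through `ϑ`, NOT yet print's `Π chartJac ∕ |det ∂_{b₀}Q̃|` in DEF-1's coordinates ((B-d′)); (B-e)∕(B-★)∕(B-T2) NOT here; nothing of (2.10)–(2.14)'s estimates;
`FEChartLawStep`∕`FEStepBox` inhabited nowhere; `stub_P0C`∕`stub_FEstep` OPEN; ⟨27930⟩ OPEN 1∕3; N09∕N11∕K1 untouched; NODE O 0∕1; COUNT 8∕28 · K 1∕4 UNMOVED; finite `𝕋⁴_{L^K}` at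
fixed ε — NOT continuum ∕ OS; **the Yang–Mills mass gap (Clay) is NOT proved by any of this.**  No `sorry`, no `def`, no `instance`; standard axioms only.
-/

noncomputable section

open MeasureTheory ProbabilityTheory Set Function Filter Topology
open scoped ENNReal NNReal BigOperators

namespace Summit.QuantumFields.YangMills.Theorems.BalabanUVNodesPortS1

open Literature.MathematicalPhysics.QuantumFieldTheory.Balaban1983to89
open Literature.MathematicalPhysics.QuantumFieldTheory.Balaban1983to89.T4AveragingDisintegration
open Literature.MathematicalPhysics.QuantumFieldTheory.Balaban1983to89.BlockAveraging (Small Idx avgFun loopHol)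
open Literature.MathematicalPhysics.QuantumFieldTheory.Balaban1983to89.BlockAveragingHaarAC (centralBond pre post centralBond_injective isLocal_avgFun)
open Literature.MathematicalPhysics.QuantumFieldTheory.Balaban1983to89.BlockAveragingEMLHaarAC (fibreFamily offCard)
open Literature.MathematicalPhysics.QuantumFieldTheory.Balaban1983to89.ExpMeanLog (expMeanLogSU deltaSU)
open Summit.QuantumFields.YangMills.Theorems.BalabanUVNodesN11TransportOfRecordInPrivateCoordinateChart (succ_le_m_add_K transportOfRecord_ae_eq_integral_privateChart_of_support)
open Summit.QuantumFields.YangMills.BalabanUVNodes.N09CentralWindowAtRecord (measurableSet_centralWindow centralWindow_extend self_mem_centralWindow_iff)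
open Node00 hiding SU
open T4Continuum

/-! ## The transform of record over the off-central bond variables, explicit continuous blind density -/

section Record

variable {F : T4Family} {N : ℕ} [NeZero N] {K k : ℕ}

/-- ★★★ **THE TRANSFORM OF RECORD OVER THE OFF-CENTRAL BOND VARIABLES ONLY, THROUGH AN EXPLICIT-DENSITY CONTINUOUS BLIND CHART OF THE CENTRAL α-WINDOW** (`k < K`, `0 ≤ α ≤ 1∕24`,
`64α ≤ δ_N`, `157α < L^{−(d−1)}`, `offCard∕|Idx| + 150α < 1`, dummy configuration `U₀`): the twenty-six clauses of ✓`exists_blindSharpPerBondCharts_centralWindow_record` AND, for every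
`dU`-integrable measurable `ρ` supported in the small-loop region, N11's transport identity with the central bond variables integrated out.
[cite: Balaban1987RG1, (2.10) p.267, p.268, (0.4) p.253; Balaban1988Convergent, (3.1) p.264, p.267 L18–24; Kechris1995, Thm 15.1; Helgason2000, Ch. I §1 Thm. 1.14 (12)-(13) p. 96] -/
theorem transportOfRecord_ae_eq_integral_offCentral_sharp_record (hk : k < K) {α : ℝ} (hα0 : 0 ≤ α) (hα : α ≤ 1 / 24) (hα64 : 64 * α ≤ deltaSU (Fin N))
    (hαL : 157 * α < (((F.P K).L : ℝ) ^ ((F.P K).d - 1))⁻¹)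
    (hgap : ∀ c : PBond (F.P K) (k + 1), (offCard c : ℝ) / (Fintype.card (Idx (F.P K)) : ℝ) + 150 * α < 1) (U₀ : GaugeField (F.P K) k (SU N)) :
    ∃ (T : PBond (F.P K) (k + 1) → GaugeField (F.P K) k (SU N) → Set (SU N))
      (ϑ : PBond (F.P K) (k + 1) → GaugeField (F.P K) k (SU N) → SU N → SU N)
      (jd jac' : PBond (F.P K) (k + 1) → GaugeField (F.P K) k (SU N) → SU N → ℝ≥0),
      (∀ c, MeasurableSet {p : GaugeField (F.P K) k (SU N) × SU N | p.2 ∈ T c p.1}) ∧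
      (∀ c, Measurable fun p : GaugeField (F.P K) k (SU N) × SU N => ϑ c p.1 p.2) ∧
      (∀ c, Measurable fun p : GaugeField (F.P K) k (SU N) × SU N => jd c p.1 p.2) ∧
      (∀ c U, ∀ v ∈ T c U, (avOfRecord F N K k).avg (update U (centralBond c) (ϑ c U v)) c = v) ∧
      (∀ c U, (HaarData.haar : Measure (SU N)).restrict {g : SU N | ∀ i : Idx (F.P K), dist1 (fibreFamily U c (pre U c * g * post U c) i) ≤ α} =
        (((HaarData.haar : Measure (SU N)).restrict (T c U)).withDensity fun v => (jd c U v : ℝ≥0∞)).map (ϑ c U)) ∧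
      (∀ c U, T c U = (fun g => (avOfRecord F N K k).avg (update U (centralBond c) g) c) ''
          {g : SU N | ∀ i : Idx (F.P K), dist1 (fibreFamily U c (pre U c * g * post U c) i) ≤ α}) ∧
      (∀ c U g, (∀ i : Idx (F.P K), dist1 (fibreFamily U c (pre U c * g * post U c) i) ≤ α) →
          ϑ c U ((avOfRecord F N K k).avg (update U (centralBond c) g) c) = g) ∧
      (∀ c U, ∀ v ∈ T c U, ∀ i : Idx (F.P K), dist1 (fibreFamily U c (pre U c * ϑ c U v * post U c) i) ≤ α) ∧
      (∀ c U v, jd c U v = (jac' c U (ϑ c U v))⁻¹) ∧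
      (∀ c U, ∀ v ∈ T c U, jd c U v ≠ 0) ∧
      (∀ c, Measurable fun p : GaugeField (F.P K) k (SU N) × SU N => jac' c p.1 p.2) ∧
      (∀ c U g, (∀ i : Idx (F.P K), dist1 (fibreFamily U c (pre U c * g * post U c) i) ≤ α) → jac' c U g ≠ 0) ∧
      (∀ c U, (HaarData.haar : Measure (SU N)).restrict
          ((fun g => (avOfRecord F N K k).avg (update U (centralBond c) g) c) ''
            {g : SU N | ∀ i : Idx (F.P K), dist1 (fibreFamily U c (pre U c * g * post U c) i) ≤ α}) =
        (((HaarData.haar : Measure (SU N)).restrict {g : SU N | ∀ i : Idx (F.P K), dist1 (fibreFamily U c (pre U c * g * post U c) i) ≤ α}).withDensity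
            fun g => (jac' c U g : ℝ≥0∞)).map (fun g => (avOfRecord F N K k).avg (update U (centralBond c) g) c)) ∧
      (∀ c U, ContinuousOn (jac' c U) {g : SU N | ∀ i : Idx (F.P K), dist1 (fibreFamily U c (pre U c * g * post U c) i) ≤ α}) ∧
      (∀ c, IsClosed {q : GaugeField (F.P K) k (SU N) × SU N | q.2 ∈ T c q.1}) ∧
      (∀ c, ContinuousOn (fun q : GaugeField (F.P K) k (SU N) × SU N => ϑ c q.1 q.2) {q : GaugeField (F.P K) k (SU N) × SU N | q.2 ∈ T c q.1}) ∧
      ContinuousOn (fun p : (PBond (F.P K) (k + 1) → SU N) × GaugeField (F.P K) k (SU N) =>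
          (extend centralBond (fun c => ϑ c p.2 (p.1 c)) p.2 : GaugeField (F.P K) k (SU N)))
        {p : (PBond (F.P K) (k + 1) → SU N) × GaugeField (F.P K) k (SU N) | ∀ c, p.1 c ∈ T c p.2} ∧
      (∀ c U, IsCompact (T c U)) ∧
      (∀ c U, ContinuousOn (jd c U) (T c U)) ∧
      (∀ c U (g : PBond (F.P K) (k + 1) → SU N), T c (extend centralBond g U) = T c U) ∧
      (∀ c U (g : PBond (F.P K) (k + 1) → SU N), ϑ c (extend centralBond g U) = ϑ c U) ∧
      (∀ c U (g : PBond (F.P K) (k + 1) → SU N), jd c (extend centralBond g U) = jd c U) ∧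
      (∀ c U (g : PBond (F.P K) (k + 1) → SU N), jac' c (extend centralBond g U) = jac' c U) ∧
      (∀ {ρ : Density (F.P K) k (SU N)}, Measurable ρ → Integrable ρ (fieldMeasure (F.P K) k (SU N)) →
        (∀ U, ρ U ≠ 0 → ∀ (c : PBond (F.P K) (k + 1)) (i : Idx (F.P K)), dist1 (loopHol U c i) ≤ α) →
        transportOfRecord F N K k ρ =ᵐ[fieldMeasure (F.P K) (k + 1) (SU N)] fun V =>
          ∫ U' : {b : PBond (F.P K) k // ¬ b ∈ Set.range (centralBond : PBond (F.P K) (k + 1) → PBond (F.P K) k)} → SU N,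
            (fun U : GaugeField (F.P K) k (SU N) =>
              (({p : GaugeField (F.P K) (k + 1) (SU N) × GaugeField (F.P K) k (SU N) | ∀ c, p.1 c ∈ T c p.2}.indicator
                (fun p => ∏ c, jd c p.2 (p.1 c)) (V, U) : ℝ≥0) : ℝ) * ρ (extend centralBond (fun c => ϑ c U (V c)) U))
              (fun b => if h : b ∈ Set.range (centralBond : PBond (F.P K) (k + 1) → PBond (F.P K) k) then U₀ b else U' ⟨b, h⟩)
            ∂(Measure.pi fun _ => (HaarData.haar : Measure (SU N)))) := by
  classical
  have hkr : k + 1 ≤ (F.P K).m + (F.P K).K := succ_le_m_add_K hk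
  obtain ⟨T, ϑ, jd, jac', hTm, hθm, hjm, hright, hlaw, hTim, hleft, hθwin, hQ, hP, hjacm, hjac0, hfwd, hjacc, hC1, hC2, hC3, hC4, hjdc,
    hTbl, hθbl, hjbl, hjacbl⟩ := exists_blindSharpPerBondCharts_centralWindow_record (F := F) (N := N) hk hα0 hα hα64 hαL hgap
  refine ⟨T, ϑ, jd, jac', hTm, hθm, hjm, hright, hlaw, hTim, hleft, hθwin, hQ, hP, hjacm, hjac0, hfwd, hjacc, hC1, hC2, hC3, hC4, hjdc,
    hTbl, hθbl, hjbl, hjacbl, fun {ρ} hρm hρ hS => ?_⟩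
  have hS' : ∀ U, ρ U ≠ 0 → ∀ c : PBond (F.P K) (k + 1),
      U (centralBond c) ∈ {g : SU N | ∀ i : Idx (F.P K), dist1 (fibreFamily U c (pre U c * g * post U c) i) ≤ α} :=
    fun U hU c => (self_mem_centralWindow_iff hkr U c α).2 (hS U hU c)
  have htr := transportOfRecord_ae_eq_integral_privateChart_of_support
    (fun c U => {g : SU N | ∀ i : Idx (F.P K), dist1 (fibreFamily U c (pre U c * g * post U c) i) ≤ α}) T ϑ jd hk
    (fun c => measurableSet_centralWindow c α) hTm hθm hjm (fun c U g' => centralWindow_extend hkr c α U g') hright hlaw hρm hρ hS'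
  filter_upwards [htr] with V hV
  rw [hV, integral_privateChart_eq_integral_offCentral hk hTbl hθbl hjbl]

end Record

end Summit.QuantumFields.YangMills.Theorems.BalabanUVNodesPortS1

end
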